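import Literature.MathematicalPhysics.QuantumFieldTheory.Balaban1983to89.B9CubeLettersBondOpsL0
import Literature.MathematicalPhysics.QuantumFieldTheory.Balaban1983to89.B9Thm37CubeCoverCommutators
import Literature.MathematicalPhysics.QuantumFieldTheory.Balaban1983to89.B6QGQCoerciveMultiLevelBox
import Literature.MathematicalPhysics.QuantumFieldTheory.Balaban1983to89.B6QGQCoerciveMultiLevelBoxL0
import Literature.MathematicalPhysics.QuantumFieldTheory.Balaban1983to89.B9Thm39CinvSandwichQ
import Literature.MathematicalPhysics.QuantumFieldTheory.Balaban1983to89.B9Cor36CubeSandwichQ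
import Literature.MathematicalPhysics.QuantumFieldTheory.Balaban1983to89.B9Cor36CinvCubeLocLetter

/-!
# `Balaban1983to89.B9Eq3105FamThreeLocResolvent` — FAMILY 3 OF (3.105), THE LOCATED `C`-DIFFERENCE WORD `hP3` (D2): THE EXACT LOCATED RESOLVENT IDENTITY
# `M_χ·(S − S_□)·M_χ′ = M_χ·Q′*X⁻¹·(T·X_□ − X·T)·X_□⁻¹Q′_□·M_χ′`, `S = Q′*X⁻¹Q′(U)`, `S_□ = Q′*_□X_□⁻¹Q′_□(V)`, `T = Q′(U)∘Q′*_□(V)`, across the member's and the cube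
# sequence's coarse lattices — pure algebra under `X`, `X_□` invertible and the near-□ agreement of the two projections `Q′*Q′`, `Q′*_□Q′_□` seen by the cut-offs,
# with `Q′(U)∘Q′*(U) = 1` and `Q′_□(V)∘Q′*_□(V) = 1` PROVED here (§3: block mean of a transported block-constant function; `#B(y) = (L^jη)^{d+1}`) and the
# near-agreements DISCHARGED from a common-block window (§5, p21's bridge lemmas by name) — only `IsUnit X`, `IsUnit X_□` stay displayed
# (programme FAMTHREE, F3-B3 FILE 1 (+ FILE 1b + FILE 2 §1) of p33 g103's `g103/F3B3-SCOPE-v2.md` §«The exact located resolvent identity»; sub-row G-B9-LETTERS, GAPS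
# G-B9-05∕family 3 D2; lead g35 RULING FAMTHREE-3b (3) «after F3-E3: F3-B3 file 1 (D2)»; seat p38 g47 2026-08-29)

statement-level skeleton of published theorems with citation tags; proofs where landed; nothing here is a claim about the Yang–Mills mass gap

THE PRINTED LOCUS (verbatim, held `paper:balaban1985-cmp99-background-propagators`, journal page = PDF page + 388).  p. 415 l. 29–31: «Next we replace the
operators G′_{□₀} and C_{□₀} by G′_□, C_□, terms with the differences G′_{□₀} − G′_□ and C_{□₀} − C_□ are small by the same reason as before.»; p. 412 l. 22–36
(«We have proved in [2] that if we have a difference of propagators defined on two domains …»); (3.95) p. 411; (3.25) p. 394–395 (`R = I − G′Q′*(Q′G′²Q′*)⁻¹Q′G′`,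
the letter `(Q′G′²Q′*)⁻¹`); (3.48) p. 398 (Thm 3.2: print's BLOCK letter `C(U) = (Q′(U)G′²(U)Q′*(U))⁻¹`, cube twin `C_□(U) = (Q′(U)G′_□²(U)Q′*(U))⁻¹` p. 409 l. 3–4); (3.21)
p. 394 (`Q′`, `Q′*`).  NAMING: the SITE composite `S := Q′*X⁻¹Q′ = Q′*·C·Q′` (and `S_□`) is the TREE's letter (F3-C ∕ F3-P's `S = Q′*X⁻¹Q′`, `X = Q′G′²Q′*`), not print's `C`.  [2] = `Balaban1983RegularityDecay` (1.11)–(1.12): STATEMENT TYPE ONLY —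
print's domain-difference mechanism is not transcribed; the identity below is OURS (a resolvent step across two coarse lattices), the algebraic backbone of the
tree's road to D2 (p33 `F3B3-SCOPE-v2.md`).

WHY THIS FILE.  After F3-A∕B∕C∕P∕E the record `B9Eq3105FamThreeLocDiffGOfEBlock.hasMajorant_sum_famThree_at_locCfg_chiL` displays, per cube, the located
`C`-difference entry `hP3 □ : conj b((D_{U₁}·M_χl·B·(S − S_□)·B·M_χl·D*_{U₁})^ℝ) ≺ ε₃ℓ(a)⁻²e^{−ρd}`, `B = G′_□(V′)`, `S = Q′*X⁻¹Q′(U₁)` (member letters `QpsY∘XinvY∘QpY`),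
`S_□ = Q′*_□X_□⁻¹Q′_□(V′)` (cube letters `QpsCubeY∘XinvCubeY∘QpCubeY`).  In the (R)-design the member's and the cube sequence's `C`-letters live on DIFFERENT coarse
lattices (`BlkY` vs `BlkCubeY □`), so «C − C_□» exists only through the site words `S, S_□`.  THIS FILE supplies the exact algebra that reduces `M_χ(S − S_□)M_χ′`
(after the two-sided plateau insertion `sandwich_split`) to ONE bracket `T·X_□ − X·T = Q′(U)·(P_□·K_□ − K·P)·Q′*_□(V)` (`K = G′²`, `P = Q′*Q′`) between the
resolvent letters `Q′*X⁻¹` and `X_□⁻¹Q′_□` — the object F3-B3 FILES 2–3 majorise (Theorem-D middle on the common blocks + collar gap pieces, `F3B3-SCOPE-v2.md`).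
No intertwiner is needed to STATE it: `P`, `P_□` are site operators and `T : (BlkCubeY □ → 𝔸) → (BlkY → 𝔸)` is the composite `Q′(U)∘Q′*_□(V)`.

WHAT THIS FILE CERTIFIES (kernel-checked; 0 `def`, 0 `def … : Prop`, 0 sorry; standard axioms only)

* §1 (any ring) ★ `sub_eq_resolvent_form` ((I): `S·A = P`, `A_b·S_b = P_b` ⟹ `S − S_b = S(A_b − A)S_b + S(1 − P_b) − (1 − P)S_b`), ★ `cut_sub_cut_eq_resolvent_form`
  ((II): + `S·P = S`, `P_b·S_b = S_b`, `M·P = M·P_b`, `P·M′ = P_b·M′` ⟹ `M(S − S_b)M′ = M·S(A_b − A)S_b·M′`), `middle_eq_transfer_form`, `sandwich_split`.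
* §2 (at the letters, any `parS`, `Gp`, `U`, `V`) `S_mul_A_eq_P`, `S_mul_P_eq_S` (member: `Q′Q′* = 1`, `IsUnit X`), `Ab_mul_Sb_eq_Pb`, `Pb_mul_Sb_eq_Sb` (cube: `Q′_□Q′*_□ = 1`,
  `IsUnit X_□`), ★★ `cut_locCDiff_cut_eq`:
  `M_χ·((QpsY∘XinvY∘QpY)(U) − (QpsCubeY∘XinvCubeY∘QpCubeY)(V))·M_χ′ = M_χ·(QpsY(U)∘XinvY(U)∘((QpY(U)∘QpsCubeY(V))∘XCubeY(V) − XY(U)∘(QpY(U)∘QpsCubeY(V)))∘XinvCubeY(V)∘QpCubeY(V))·M_χ′`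
  under `hQQ`, `hQQc`, `hX`, `hXc` and the displayed near-agreements `hMP`, `hPM′`; `transfer_bracket_eq` (`T·X_□ − X·T = Q′(U)∘(P_□∘G′_□² − G′²∘P)∘Q′*_□(V)`, by `rfl`-unfolding).
* §3 ★ `QpY_QpsY_apply` (r05 `B9Thm39CinvSandwichQ.QpsY_apply` BY NAME), ★★ `QpY_comp_QpsY : QpY i parS U ∘ₗ QpsY i parS U = LinearMap.id`; ★ `QpCubeY_QpsCubeY_apply` (`B9Cor36CubeSandwichQ.QpsCubeY_apply` BY NAME),
  ★★ `QpCubeY_comp_QpsCubeY : QpCubeY i □ parS V ∘ₗ QpsCubeY i □ parS V = LinearMap.id` — from `B6QGQCoerciveMultiLevelBox(L0).card_blkOf_eq` (`#B(y) = W(y)`) and `R(τ)R(τ⁻¹) = 1`.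
* §4 ★★★ `cut_locCDiff_cut_eq'` — the located resolvent identity with `hQQ`, `hQQc` DISCHARGED (only `IsUnit X`, `IsUnit X_□`, `hMP`, `hPM′` displayed).
* §5 `QpCubeY_apply_congr_cfg`, ★ `P_apply_eq_Pb_apply` (at a site of a common block with agreeing transporters `(Q′*Q′(U)Λ)(z) = (Q′*_□Q′_□(V)Λ)(z)`),
  ★★ `cutMulY_P_eq_cutMulY_Pb` (the LEFT near-agreement `hMP`), ★★ `P_mul_cutMulY_eq_Pb_mul_cutMulY` (the RIGHT near-agreement `hPM′`, with the block-locality of `Q′`, `Q′_□`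
  off the window), both from a common-block window `N` (`hN : s.1 ∈ bset i.D.toDomains`, `supp χ ⊂ ⋃ N`, transporters of `U`, `V` agree on the `N`-blocks) — p21's bridge
  lemmas `blkOf_val_eq_of_mem` ∕ `blkOf_eq_iff_of_val_eq` ∕ `qpT_eq_qpTc` ∕ `QpY_apply_eq_QpCubeY_apply` BY NAME; ★★★ `cut_locCDiff_cut_eq_of_window` — the located resolvent
  identity with EVERYTHING DISCHARGED BUT THE UNITS (`IsUnit X(U)`, `IsUnit X_□(V)`) from such a window.

HONEST SCOPE ∕ NOT CLAIMED.  Pure algebra; no estimate.  DISPLAYED hypotheses of the final form: `IsUnit (XY …)`, `IsUnit (XCubeY …)` (Thm 3.2's regime; displayed everywhere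
in the tree) and the WINDOW data (`N`, `hN`, `hχ`, `hχ′`, `hagree` — at the (3.35) datum: `N` = the cube blocks inside `NearC 3S_j` (common by r05
`coarsen_blkOf_val_of_nearH`), `hagree` from `V′ = U₁` on `NearC 3.75S_j` (F3-P `window_of_UboxY_agree`) via p21 `parS_agree_of_agreeNearY` — FILE 2's datum plug); in §2–§4 also the
NEAR-AGREEMENTS `hMP`, `hPM′` (discharged in §5 from a window).  `hP3` itself stays displayed at the record until FILES 2–3 (the Theorem-D middle on the common
blocks + the collar gap pieces + the leaks, `F3B3-SCOPE-v2.md` §«The analysis»).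
Count-neutral; NOT a node discharge; no summit ∕ sub-problem statement is proved; nothing continuum ∕ OS ∕ mass-gap ∕ Clay; YM mass gap NOT proved (Track A
conditional rung).  No `sorry`, no `axiom`, no `… : Prop` fact, no `instance`, no `notation`, no `def`.  NEW file; nothing landed is modified.  Cell `lit-balaban`,
seat `lit-balaban-p38` gen 47, 2026-08-29; `--supports stmt-QuantumFields-19200` as helper.  Net new unproved facts: 0.

RELATED IN THE TREE, NOT DUPLICATED (searched 2026-08-29: `rg 'resolvent_form|LocResolvent|locCDiff|QpY_comp_QpsY|QpY_QpsY' Literature/MathematicalPhysics` = ∅; the tree had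
`card_blkOf_le`∕`card_blkOf_eq` and n06-j `isAdjTr_QpY_QpsY` (adjointness), but no `Q′∘Q′* = 1`): p33 F3-E1 `B9Eq3105FamThreeLocDiffG`
(`cut_sub_eq_oneSided` ∕ `sub_cut_eq_oneSided` — the ONE-sided identities for `G′ − G′_□`; this file is the TWO-lattice analogue for `C`), p21 `B9ThmDLocDiffAlgebra.sub_eq_comm_form`
(the commutator form for `X = Q′G′²Q′*`, not `X⁻¹`), p21 M5.2-E `B9Cor36CinvCubeLocLetter` (the block bridge `J`∕`J⋆` and common-pair lemmas — USED for FILE 2, cited here),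
r05 `B9CubeLettersBondOpsL0` (`XCubeY`, `XinvCubeY`, `XCubeY_mul_XinvCubeY` — USED BY NAME), Node00 `OpsYDeltaA` (`QpY`, `QpsY`, `XY`, `XinvY`, `trLiftY_apply`),
r03-lineage `B6QGQCoerciveMultiLevelBox.card_blkOf_eq` ∕ `…L0.card_blkOf_eq` (USED BY NAME), `B9Eq39Adjoint.R_R_inv`.
-/

noncomputable section

namespace Literature.MathematicalPhysics.QuantumFieldTheory.Balaban1983to89.B9Eq3105FamThreeLocResolvent

open B6KLevelCensusIndexV1 (KIdx)
open B6Cover236MultiLevelBlocks (cubes)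
open B9Thm37CubeCoverCommutators (cutMulY)
open B9Eq39Adjoint (R R_R_inv R_zero)
open B6Geom246MultiLevelBox (bset blkOf)
open B6Ineq268MultiLevelBox (W W_pos)
open B9CubeLettersOpsL0 (cubeFamY GpCubeY)
open B9CubeLettersBondOpsL0 (BlkCubeY qpKc qpsKc qpTc blkCornerCubeY QpCubeY QpsCubeY XCubeY XinvCubeY XCubeY_mul_XinvCubeY)
open Node00 (SiteY BlkY CfgY SiteOpY SiteParY toKT QpY QpsY XY XinvY qpK qpsK qpT trLiftY trLiftY_apply)
open B9Thm37CubeCoverCommutators (cutMulY_apply)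
open B9Thm39CinvSandwichQ (QpsY_apply QpY_apply_eq_zero_of)
open B9Cor36CubeSandwichQ (QpsCubeY_apply QpCubeY_apply_eq_zero_of)
open B9Eq357CubeLetters (qpKc_of_blkOf_ne)
open B9Cor36CinvCubeLocLetter (blkOf_eq_iff_of_val_eq blkOf_val_eq_of_mem qpT_eq_qpTc QpY_apply_eq_QpCubeY_apply)

/-! ## §1  The resolvent-type identities in a ring (pure algebra) -/

section Ring

variable {R : Type} [Ring R]

/-- ★ **(I)**: `S·A = P`, `Ab·Sb = Pb` ⟹ `S − Sb = S·(Ab − A)·Sb + S·(1 − Pb) − (1 − P)·Sb`. [cite: Balaban1985BackgroundPropagators, (3.95) p.411, p.415 l.29–37; Balaban1983RegularityDecay, (1.11)–(1.12) (statement type; algebra ours)] -/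
theorem sub_eq_resolvent_form (S Sb A Ab P Pb : R) (hSA : S * A = P) (hAbSb : Ab * Sb = Pb) :
    S - Sb = S * (Ab - A) * Sb + S * (1 - Pb) - (1 - P) * Sb := by
  have e1 : S * (Ab - A) * Sb = S * (Ab * Sb) - (S * A) * Sb := by noncomm_ring
  rw [e1, hAbSb, hSA]
  noncomm_ring

/-- ★ **(II), the located form**: if moreover `S·P = S`, `Pb·Sb = Sb` and the cut-offs `M, M′` see the two projections agree — `M·P = M·Pb`, `P·M′ = Pb·M′` — then
`M·(S − Sb)·M′ = M·S·(Ab − A)·Sb·M′` (both correction terms vanish). [cite: Balaban1985BackgroundPropagators, (3.95) p.411, p.412 l.22–36, p.415 l.29–37] -/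
theorem cut_sub_cut_eq_resolvent_form (S Sb A Ab P Pb M M' : R) (hSA : S * A = P) (hAbSb : Ab * Sb = Pb) (hSP : S * P = S) (hPbSb : Pb * Sb = Sb)
    (hMP : M * P = M * Pb) (hPM' : P * M' = Pb * M') :
    M * (S - Sb) * M' = M * S * (Ab - A) * Sb * M' := by
  rw [sub_eq_resolvent_form S Sb A Ab P Pb hSA hAbSb]
  have h1 : S * (1 - Pb) * M' = 0 := by
    have e : S * (1 - Pb) * M' = S * M' - S * (Pb * M') := by noncomm_ring
    rw [e, ← hPM', ← mul_assoc, hSP, sub_self]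
  have h2 : M * ((1 - P) * Sb) = 0 := by
    have e : M * ((1 - P) * Sb) = M * Sb - (M * P) * Sb := by noncomm_ring
    rw [e, hMP, mul_assoc, hPbSb, sub_self]
  have e3 : M * (S * (Ab - A) * Sb + S * (1 - Pb) - (1 - P) * Sb) * M' =
      M * S * (Ab - A) * Sb * M' + M * (S * (1 - Pb) * M') - M * ((1 - P) * Sb) * M' := by noncomm_ring
  rw [e3, h1, h2, mul_zero, zero_mul, add_zero, sub_zero]

/-- the transfer form of the middle: `S·Ab·Sb − S·A·Sb` with `S = s·Xi·q`, `Sb = sb·Xbi·qb`, `A = s·X·q`, `Ab = sb·Xb·qb`, `q·s = 1`, `qb·sb = 1`: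
`S·(Ab − A)·Sb = s·Xi·((q·sb)·Xb − X·(q·sb))·Xbi·qb`. [cite: Balaban1985BackgroundPropagators, (3.25) p.394, (3.95) p.411; algebra ours] -/
theorem middle_eq_transfer_form (s q sb qb X Xi Xb Xbi : R) (hqs : q * s = 1) (hqbsb : qb * sb = 1) :
    (s * Xi * q) * ((sb * Xb * qb) - (s * X * q)) * (sb * Xbi * qb) = s * Xi * ((q * sb) * Xb - X * (q * sb)) * Xbi * qb := by
  have e1 : (s * Xi * q) * ((sb * Xb * qb) - (s * X * q)) * (sb * Xbi * qb) =
      s * Xi * (q * sb) * Xb * (qb * sb) * Xbi * qb - s * Xi * (q * s) * X * (q * sb) * Xbi * qb := by noncomm_ring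
  rw [e1, hqbsb, hqs]
  noncomm_ring

/-- the two-sided insertion of a plateau cut-off `M` around the difference, inside the sandwich `B·(S − Sb)·B` of F3-B's `hP3` word:
`B(S − Sb)B = B·M(S − Sb)M·B + B·M(S − Sb)(1 − M)·B + B·(1 − M)(S − Sb)·B` (core + right leak + left leak). [cite: Balaban1985BackgroundPropagators, p.415 l.26–37, p.412 l.22–36; algebra ours] -/
theorem sandwich_split (B S Sb M : R) :
    B * (S - Sb) * B = B * (M * (S - Sb) * M) * B + B * (M * (S - Sb) * (1 - M)) * B + B * ((1 - M) * (S - Sb)) * B := by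
  noncomm_ring

end Ring

/-! ## §2  At the letters: `S = Q′*X⁻¹Q′(U₁)` (member), `S_□ = Q′*_□X_□⁻¹Q′_□(V′)` (cube sequence), `P = Q′*Q′`, `P_□ = Q′*_□Q′_□`, `T = Q′(U₁)∘Q′*_□(V′)` -/

section Letters

variable {d ℓ : ℕ} {hd : 1 ≤ d + 1} {hL : Odd (ℓ + 1) ∧ 1 < ℓ + 1} {b₀ b₁ : ℝ}
variable {𝔸 : Type} [NormedRing 𝔸] [NormedAlgebra ℂ 𝔸] [CompleteSpace 𝔸]
variable (i : KIdx d ℓ hd hL b₀ b₁) (c : ↥(cubes (toKT i).D.toDomains)) (parS : SiteParY 𝔸 i) (Gp : SiteOpY 𝔸 i) (U V : CfgY 𝔸 i)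

/-- `S·A = P` at the member letters: `Q′*X⁻¹Q′ · Q′*XQ′ = Q′*Q′` (`Q′Q′* = 1`, `X⁻¹X = 1`). [cite: Balaban1985BackgroundPropagators, (3.25) p.394, (3.48) p.398] -/
theorem S_mul_A_eq_P (hQQ : QpY i parS U ∘ₗ QpsY i parS U = LinearMap.id) (hX : IsUnit (XY i parS Gp U)) :
    (QpsY i parS U ∘ₗ XinvY i parS Gp U ∘ₗ QpY i parS U) * (QpsY i parS U ∘ₗ XY i parS Gp U ∘ₗ QpY i parS U) =
      (QpsY i parS U ∘ₗ QpY i parS U : Module.End ℂ (SiteY i → 𝔸)) := by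
  have hXX : XinvY i parS Gp U * XY i parS Gp U = 1 := Ring.inverse_mul_cancel _ hX
  have h1 : ∀ v, QpY i parS U (QpsY i parS U v) = v := fun v => by
    have := LinearMap.congr_fun hQQ v; simpa using this
  have h2 : ∀ v, XinvY i parS Gp U (XY i parS Gp U v) = v := fun v => by
    have := LinearMap.congr_fun hXX v; simpa using this
  refine LinearMap.ext fun Λ => ?_
  simp only [Module.End.mul_apply, LinearMap.comp_apply, h1, h2]

/-- `S·P = S` at the member letters. [cite: Balaban1985BackgroundPropagators, (3.25) p.394, bookkeeping] -/
theorem S_mul_P_eq_S (hQQ : QpY i parS U ∘ₗ QpsY i parS U = LinearMap.id) :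
    (QpsY i parS U ∘ₗ XinvY i parS Gp U ∘ₗ QpY i parS U) * (QpsY i parS U ∘ₗ QpY i parS U) =
      (QpsY i parS U ∘ₗ XinvY i parS Gp U ∘ₗ QpY i parS U : Module.End ℂ (SiteY i → 𝔸)) := by
  have h1 : ∀ v, QpY i parS U (QpsY i parS U v) = v := fun v => by
    have := LinearMap.congr_fun hQQ v; simpa using this
  refine LinearMap.ext fun Λ => ?_
  simp only [Module.End.mul_apply, LinearMap.comp_apply, h1]

/-- `A_□·S_□ = P_□` at the cube letters: `Q′*_□X_□Q′_□ · Q′*_□X_□⁻¹Q′_□ = Q′*_□Q′_□`. [cite: Balaban1985BackgroundPropagators, (3.25) p.394, p.409] -/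
theorem Ab_mul_Sb_eq_Pb (hQQc : QpCubeY i c parS V ∘ₗ QpsCubeY i c parS V = LinearMap.id) (hXc : IsUnit (XCubeY i c parS V)) :
    (QpsCubeY i c parS V ∘ₗ XCubeY i c parS V ∘ₗ QpCubeY i c parS V) * (QpsCubeY i c parS V ∘ₗ XinvCubeY i c parS V ∘ₗ QpCubeY i c parS V) =
      (QpsCubeY i c parS V ∘ₗ QpCubeY i c parS V : Module.End ℂ (SiteY i → 𝔸)) := by
  have hXX : XCubeY i c parS V * XinvCubeY i c parS V = 1 := XCubeY_mul_XinvCubeY i c hXc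
  have h1 : ∀ v, QpCubeY i c parS V (QpsCubeY i c parS V v) = v := fun v => by
    have := LinearMap.congr_fun hQQc v; simpa using this
  have h2 : ∀ v, XCubeY i c parS V (XinvCubeY i c parS V v) = v := fun v => by
    have := LinearMap.congr_fun hXX v; simpa using this
  refine LinearMap.ext fun Λ => ?_
  simp only [Module.End.mul_apply, LinearMap.comp_apply, h1, h2]

/-- `P_□·S_□ = S_□` at the cube letters. [cite: Balaban1985BackgroundPropagators, (3.25) p.394, bookkeeping] -/
theorem Pb_mul_Sb_eq_Sb (hQQc : QpCubeY i c parS V ∘ₗ QpsCubeY i c parS V = LinearMap.id) :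
    (QpsCubeY i c parS V ∘ₗ QpCubeY i c parS V) * (QpsCubeY i c parS V ∘ₗ XinvCubeY i c parS V ∘ₗ QpCubeY i c parS V) =
      (QpsCubeY i c parS V ∘ₗ XinvCubeY i c parS V ∘ₗ QpCubeY i c parS V : Module.End ℂ (SiteY i → 𝔸)) := by
  have h1 : ∀ v, QpCubeY i c parS V (QpsCubeY i c parS V v) = v := fun v => by
    have := LinearMap.congr_fun hQQc v; simpa using this
  refine LinearMap.ext fun Λ => ?_
  simp only [Module.End.mul_apply, LinearMap.comp_apply, h1]

/-- ★★ **THE EXACT LOCATED RESOLVENT IDENTITY AT THE LETTERS**: with `S = Q′*X⁻¹Q′ (U)`, `S_□ = Q′*_□X_□⁻¹Q′_□ (V)`, under `Q′Q′* = 1`, `Q′_□Q′*_□ = 1`, `X`, `X_□` invertible and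
the NEAR-AGREEMENT of the two projections seen by the cut-offs (`M_χ·Q′*Q′ = M_χ·Q′*_□Q′_□`, `Q′*Q′·M_χ′ = Q′*_□Q′_□·M_χ′`):
`M_χ·(S − S_□)·M_χ′ = M_χ·Q′*X⁻¹·(T·X_□ − X·T)·X_□⁻¹Q′_□·M_χ′`, `T = Q′(U)∘Q′*_□(V)`.
[cite: Balaban1985BackgroundPropagators, (3.95) p.411, p.412 l.22–36, p.415 l.29–37, (3.25) p.394–395; Balaban1983RegularityDecay, (1.11)–(1.12) (statement type; algebra ours)] -/
theorem cut_locCDiff_cut_eq (χ χ' : SiteY i → ℝ) (hQQ : QpY i parS U ∘ₗ QpsY i parS U = LinearMap.id)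
    (hQQc : QpCubeY i c parS V ∘ₗ QpsCubeY i c parS V = LinearMap.id) (hX : IsUnit (XY i parS Gp U)) (hXc : IsUnit (XCubeY i c parS V))
    (hMP : cutMulY (𝔸 := 𝔸) χ * (QpsY i parS U ∘ₗ QpY i parS U) = cutMulY (𝔸 := 𝔸) χ * (QpsCubeY i c parS V ∘ₗ QpCubeY i c parS V))
    (hPM' : (QpsY i parS U ∘ₗ QpY i parS U) * cutMulY (𝔸 := 𝔸) χ' = (QpsCubeY i c parS V ∘ₗ QpCubeY i c parS V) * cutMulY (𝔸 := 𝔸) χ') :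
    cutMulY (𝔸 := 𝔸) χ * ((QpsY i parS U ∘ₗ XinvY i parS Gp U ∘ₗ QpY i parS U) - (QpsCubeY i c parS V ∘ₗ XinvCubeY i c parS V ∘ₗ QpCubeY i c parS V)) *
        cutMulY (𝔸 := 𝔸) χ' =
      cutMulY (𝔸 := 𝔸) χ * (QpsY i parS U ∘ₗ XinvY i parS Gp U ∘ₗ
        ((QpY i parS U ∘ₗ QpsCubeY i c parS V) ∘ₗ XCubeY i c parS V - XY i parS Gp U ∘ₗ (QpY i parS U ∘ₗ QpsCubeY i c parS V)) ∘ₗ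
          XinvCubeY i c parS V ∘ₗ QpCubeY i c parS V) * cutMulY (𝔸 := 𝔸) χ' := by
  have hI := cut_sub_cut_eq_resolvent_form (R := Module.End ℂ (SiteY i → 𝔸))
    (QpsY i parS U ∘ₗ XinvY i parS Gp U ∘ₗ QpY i parS U) (QpsCubeY i c parS V ∘ₗ XinvCubeY i c parS V ∘ₗ QpCubeY i c parS V)
    (QpsY i parS U ∘ₗ XY i parS Gp U ∘ₗ QpY i parS U) (QpsCubeY i c parS V ∘ₗ XCubeY i c parS V ∘ₗ QpCubeY i c parS V)
    (QpsY i parS U ∘ₗ QpY i parS U) (QpsCubeY i c parS V ∘ₗ QpCubeY i c parS V) (cutMulY (𝔸 := 𝔸) χ) (cutMulY (𝔸 := 𝔸) χ')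
    (S_mul_A_eq_P i parS Gp U hQQ hX) (Ab_mul_Sb_eq_Pb i c parS V hQQc hXc) (S_mul_P_eq_S i parS Gp U hQQ) (Pb_mul_Sb_eq_Sb i c parS V hQQc)
    hMP hPM'
  rw [hI]
  -- the middle in transfer form, pointwise
  have hXX : XinvY i parS Gp U * XY i parS Gp U = 1 := Ring.inverse_mul_cancel _ hX
  have hXXc : XCubeY i c parS V * XinvCubeY i c parS V = 1 := XCubeY_mul_XinvCubeY i c hXc
  have h1 : ∀ v, QpY i parS U (QpsY i parS U v) = v := fun v => by
    have := LinearMap.congr_fun hQQ v; simpa using this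
  have h1c : ∀ v, QpCubeY i c parS V (QpsCubeY i c parS V v) = v := fun v => by
    have := LinearMap.congr_fun hQQc v; simpa using this
  have h2 : ∀ v, XinvY i parS Gp U (XY i parS Gp U v) = v := fun v => by
    have := LinearMap.congr_fun hXX v; simpa using this
  have h2c : ∀ v, XCubeY i c parS V (XinvCubeY i c parS V v) = v := fun v => by
    have := LinearMap.congr_fun hXXc v; simpa using this
  refine LinearMap.ext fun Λ => ?_
  simp only [Module.End.mul_apply, LinearMap.comp_apply, LinearMap.sub_apply, map_sub, h1, h1c, h2, h2c]

/-- the bracket of the transfer form: `T·X_□ − X·T = Q′(U)·(P_□·K_□ − K·P)·Q′*_□(V)`, `K = G′(U)²`, `K_□ = G′_□(V)²`, `P = Q′*Q′(U)`, `P_□ = Q′*_□Q′_□(V)`.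
[cite: Balaban1985BackgroundPropagators, (3.25) p.394–395, (3.95) p.411; algebra ours] -/
theorem transfer_bracket_eq :
    (QpY i parS U ∘ₗ QpsCubeY i c parS V) ∘ₗ XCubeY i c parS V - XY i parS Gp U ∘ₗ (QpY i parS U ∘ₗ QpsCubeY i c parS V) =
      QpY i parS U ∘ₗ ((QpsCubeY i c parS V ∘ₗ QpCubeY i c parS V) ∘ₗ (GpCubeY i c parS V ∘ₗ GpCubeY i c parS V) -
        (Gp U ∘ₗ Gp U) ∘ₗ (QpsY i parS U ∘ₗ QpY i parS U)) ∘ₗ QpsCubeY i c parS V := by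
  refine LinearMap.ext fun Λ => ?_
  simp only [XCubeY, XY, LinearMap.comp_apply, LinearMap.sub_apply, map_sub]

end Letters

/-! ## §3  `Q′(U)∘Q′*(U) = 1` (member) — the hypothesis `hQQ` DISCHARGED -/

section RightInverse

variable {d ℓ : ℕ} {hd : 1 ≤ d + 1} {hL : Odd (ℓ + 1) ∧ 1 < ℓ + 1} {b₀ b₁ : ℝ}
variable {𝔸 : Type} [NormedRing 𝔸] [NormedAlgebra ℂ 𝔸] [CompleteSpace 𝔸]
variable (i : KIdx d ℓ hd hL b₀ b₁) (parS : SiteParY 𝔸 i) (U : CfgY 𝔸 i)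

/-! ### the member's block averaging: `Q′(U)∘Q′*(U) = 1` -/

/-- ★ **`Q′(U)(Q′*(U)v) = v`**: the mean over a block of the transported block-constant function is the value (`#B(y) = W(y) = (L^jη)^{d+1}`, `R(τ)R(τ⁻¹) = 1`).
[cite: Balaban1985BackgroundPropagators, (3.21) p.394, (3.24)–(3.25) p.394; Balaban1984PropagatorsII, (2.14) p.225, (2.69) p.235] -/
theorem QpY_QpsY_apply (v : BlkY i → 𝔸) (s : BlkY i) : QpY i parS U (QpsY i parS U v) s = v s := by
  classical
  show trLiftY (qpK i) (qpT i parS U) (QpsY i parS U v) s = v s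
  rw [trLiftY_apply]
  have hterm : ∀ z : SiteY i, (((qpK i s z : ℝ)) : ℂ) • R (qpT i parS U s z) (QpsY i parS U v z) =
      (if blkOf i.D.toDomains z = s then (1 : ℂ) else 0) • ((((W i.D.toDomains s)⁻¹ : ℝ) : ℂ) • v s) := by
    intro z
    by_cases hz : blkOf i.D.toDomains z = s
    · have hq : qpK i s z = (W i.D.toDomains s)⁻¹ := by
        show (if blkOf i.D.toDomains z = s then (W i.D.toDomains s)⁻¹ else 0) = _
        rw [if_pos hz]
      rw [hq, QpsY_apply, hz, R_R_inv, if_pos rfl, one_smul]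
    · have hq : qpK i s z = 0 := by
        show (if blkOf i.D.toDomains z = s then (W i.D.toDomains s)⁻¹ else 0) = _
        rw [if_neg hz]
      rw [hq, Complex.ofReal_zero, zero_smul, if_neg hz, zero_smul]
  rw [Finset.sum_congr rfl fun z _ => hterm z, ← Finset.sum_smul, Finset.sum_boole, smul_smul]
  have hW : (W i.D.toDomains s) ≠ 0 := (W_pos i.D.toDomains s).ne'
  have hcard := B6QGQCoerciveMultiLevelBox.card_blkOf_eq i.D.toDomains s
  have e : ((((Finset.univ.filter fun z : SiteY i => blkOf i.D.toDomains z = s).card : ℕ) : ℂ) * ((((W i.D.toDomains s)⁻¹ : ℝ)) : ℂ)) = 1 := by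
    have h1 : ((((Finset.univ.filter fun z : SiteY i => blkOf i.D.toDomains z = s).card : ℕ) : ℂ)) = (((W i.D.toDomains s : ℝ)) : ℂ) := by
      rw [← hcard]; push_cast; rfl
    rw [h1, ← Complex.ofReal_mul, mul_inv_cancel₀ hW, Complex.ofReal_one]
  rw [e, one_smul]

/-- ★★ **`Q′(U)∘Q′*(U) = 1`** on block functions. [cite: Balaban1985BackgroundPropagators, (3.21) p.394, (3.24)–(3.25) p.394; Balaban1984PropagatorsII, (2.14) p.225] -/
theorem QpY_comp_QpsY : QpY i parS U ∘ₗ QpsY i parS U = LinearMap.id :=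
  LinearMap.ext fun v => funext fun s => by rw [LinearMap.comp_apply, QpY_QpsY_apply, LinearMap.id_apply]

/-! ### the cube sequence: `Q′_□(V)∘Q′*_□(V) = 1` — `hQQc` DISCHARGED -/

variable (c : ↥(cubes (toKT i).D.toDomains))

/-- ★ **`Q′_□(V)(Q′*_□(V)μ) = μ`**. [cite: Balaban1985BackgroundPropagators, (3.21) p.394, p.409; Balaban1984PropagatorsII, (2.14) p.225, (2.69) p.235] -/
theorem QpCubeY_QpsCubeY_apply (μ : BlkCubeY i c → 𝔸) (s : BlkCubeY i c) : QpCubeY i c parS U (QpsCubeY i c parS U μ) s = μ s := by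
  classical
  show trLiftY (qpKc i c) (qpTc i c parS U) (QpsCubeY i c parS U μ) s = μ s
  rw [trLiftY_apply]
  have hterm : ∀ z : SiteY i, (((qpKc i c s z : ℝ)) : ℂ) • R (qpTc i c parS U s z) (QpsCubeY i c parS U μ z) =
      (if B6Geom246MultiLevelBoxL0.blkOf (cubeFamY i c).toDomains z = s then (1 : ℂ) else 0) •
        ((((B6Ineq268MultiLevelBoxL0.W (cubeFamY i c).toDomains s)⁻¹ : ℝ) : ℂ) • μ s) := by
    intro z
    by_cases hz : B6Geom246MultiLevelBoxL0.blkOf (cubeFamY i c).toDomains z = s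
    · have hq : qpKc i c s z = (B6Ineq268MultiLevelBoxL0.W (cubeFamY i c).toDomains s)⁻¹ := by
        show (if B6Geom246MultiLevelBoxL0.blkOf (cubeFamY i c).toDomains z = s then (B6Ineq268MultiLevelBoxL0.W (cubeFamY i c).toDomains s)⁻¹ else 0) = _
        rw [if_pos hz]
      rw [hq, QpsCubeY_apply, hz, R_R_inv, if_pos rfl, one_smul]
    · have hq : qpKc i c s z = 0 := by
        show (if B6Geom246MultiLevelBoxL0.blkOf (cubeFamY i c).toDomains z = s then (B6Ineq268MultiLevelBoxL0.W (cubeFamY i c).toDomains s)⁻¹ else 0) = _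
        rw [if_neg hz]
      rw [hq, Complex.ofReal_zero, zero_smul, if_neg hz, zero_smul]
  rw [Finset.sum_congr rfl fun z _ => hterm z, ← Finset.sum_smul, Finset.sum_boole, smul_smul]
  have hW : (B6Ineq268MultiLevelBoxL0.W (cubeFamY i c).toDomains s) ≠ 0 := (B6Ineq268MultiLevelBoxL0.W_pos (cubeFamY i c).toDomains s).ne'
  have hcard := B6QGQCoerciveMultiLevelBoxL0.card_blkOf_eq (cubeFamY i c).toDomains s
  have e : ((((Finset.univ.filter fun z : SiteY i => B6Geom246MultiLevelBoxL0.blkOf (cubeFamY i c).toDomains z = s).card : ℕ) : ℂ) *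
      ((((B6Ineq268MultiLevelBoxL0.W (cubeFamY i c).toDomains s)⁻¹ : ℝ)) : ℂ)) = 1 := by
    have h1 : ((((Finset.univ.filter fun z : SiteY i => B6Geom246MultiLevelBoxL0.blkOf (cubeFamY i c).toDomains z = s).card : ℕ) : ℂ)) =
        (((B6Ineq268MultiLevelBoxL0.W (cubeFamY i c).toDomains s : ℝ)) : ℂ) := by
      rw [← hcard]; push_cast; rfl
    rw [h1, ← Complex.ofReal_mul, mul_inv_cancel₀ hW, Complex.ofReal_one]
  rw [e, one_smul]

/-- ★★ **`Q′_□(V)∘Q′*_□(V) = 1`** on the cube sequence's block functions. [cite: Balaban1985BackgroundPropagators, (3.21) p.394, p.409; Balaban1984PropagatorsII, (2.14) p.225] -/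
theorem QpCubeY_comp_QpsCubeY : QpCubeY i c parS U ∘ₗ QpsCubeY i c parS U = LinearMap.id :=
  LinearMap.ext fun μ => funext fun s => by rw [LinearMap.comp_apply, QpCubeY_QpsCubeY_apply, LinearMap.id_apply]

end RightInverse

/-! ## §4  The located resolvent identity with `Q′Q′* = 1`, `Q′_□Q′*_□ = 1` DISCHARGED (only the units and the near-agreements displayed) -/

section Discharged

variable {d ℓ : ℕ} {hd : 1 ≤ d + 1} {hL : Odd (ℓ + 1) ∧ 1 < ℓ + 1} {b₀ b₁ : ℝ}
variable {𝔸 : Type} [NormedRing 𝔸] [NormedAlgebra ℂ 𝔸] [CompleteSpace 𝔸]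
variable (i : KIdx d ℓ hd hL b₀ b₁) (c : ↥(cubes (toKT i).D.toDomains)) (parS : SiteParY 𝔸 i) (Gp : SiteOpY 𝔸 i) (U V : CfgY 𝔸 i)

/-- ★★★ **THE EXACT LOCATED RESOLVENT IDENTITY, `Q′Q′* = 1` AND `Q′_□Q′*_□ = 1` DISCHARGED** (§3): under `IsUnit X(U)`, `IsUnit X_□(V)` and the near-agreements only.
[cite: Balaban1985BackgroundPropagators, (3.95) p.411, p.412 l.22–36, p.415 l.29–37, (3.21) p.394, (3.25) p.394–395; Balaban1983RegularityDecay, (1.11)–(1.12) (statement type; algebra ours)] -/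
theorem cut_locCDiff_cut_eq' (χ χ' : SiteY i → ℝ) (hX : IsUnit (XY i parS Gp U)) (hXc : IsUnit (XCubeY i c parS V))
    (hMP : cutMulY (𝔸 := 𝔸) χ * (QpsY i parS U ∘ₗ QpY i parS U) = cutMulY (𝔸 := 𝔸) χ * (QpsCubeY i c parS V ∘ₗ QpCubeY i c parS V))
    (hPM' : (QpsY i parS U ∘ₗ QpY i parS U) * cutMulY (𝔸 := 𝔸) χ' = (QpsCubeY i c parS V ∘ₗ QpCubeY i c parS V) * cutMulY (𝔸 := 𝔸) χ') :
    cutMulY (𝔸 := 𝔸) χ * ((QpsY i parS U ∘ₗ XinvY i parS Gp U ∘ₗ QpY i parS U) - (QpsCubeY i c parS V ∘ₗ XinvCubeY i c parS V ∘ₗ QpCubeY i c parS V)) *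
        cutMulY (𝔸 := 𝔸) χ' =
      cutMulY (𝔸 := 𝔸) χ * (QpsY i parS U ∘ₗ XinvY i parS Gp U ∘ₗ
        ((QpY i parS U ∘ₗ QpsCubeY i c parS V) ∘ₗ XCubeY i c parS V - XY i parS Gp U ∘ₗ (QpY i parS U ∘ₗ QpsCubeY i c parS V)) ∘ₗ
          XinvCubeY i c parS V ∘ₗ QpCubeY i c parS V) * cutMulY (𝔸 := 𝔸) χ' :=
  cut_locCDiff_cut_eq i c parS Gp U V χ χ' (QpY_comp_QpsY i parS U) (QpCubeY_comp_QpsCubeY i parS V c) hX hXc hMP hPM'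

end Discharged

/-! ## §5  The near-agreements DISCHARGED from a common-block window (p21's bridge `B9Cor36CinvCubeLocLetter` BY NAME) -/

section Window

variable {d ℓ : ℕ} {hd : 1 ≤ d + 1} {hL : Odd (ℓ + 1) ∧ 1 < ℓ + 1} {b₀ b₁ : ℝ}
variable {𝔸 : Type} [NormedRing 𝔸] [NormedAlgebra ℂ 𝔸] [CompleteSpace 𝔸]
variable (i : KIdx d ℓ hd hL b₀ b₁) (c : ↥(cubes (toKT i).D.toDomains)) (parS : SiteParY 𝔸 i) (U V : CfgY 𝔸 i)


/-- `(Q′_□(U)Λ)(s) = (Q′_□(V)Λ)(s)` on a block `s` where the averaging transporters of `U` and `V` agree. [cite: Balaban1985BackgroundPropagators, (3.21) p.394, Cor. 3.6 p.408 l.11–14, p.410 l.14–15] -/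
theorem QpCubeY_apply_congr_cfg {s : BlkCubeY i c}
    (hagree : ∀ z, B6Geom246MultiLevelBoxL0.blkOf (cubeFamY i c).toDomains z = s → parS U (blkCornerCubeY i c s) z = parS V (blkCornerCubeY i c s) z)
    (Λ : SiteY i → 𝔸) : QpCubeY i c parS U Λ s = QpCubeY i c parS V Λ s := by
  show trLiftY (qpKc i c) (qpTc i c parS U) Λ s = trLiftY (qpKc i c) (qpTc i c parS V) Λ s
  rw [trLiftY_apply, trLiftY_apply]
  refine Finset.sum_congr rfl fun z _ => ?_
  by_cases hz : B6Geom246MultiLevelBoxL0.blkOf (cubeFamY i c).toDomains z = s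
  · show _ • R (parS U (blkCornerCubeY i c s) z) (Λ z) = _ • R (parS V (blkCornerCubeY i c s) z) (Λ z)
    rw [hagree z hz]
  · rw [qpKc_of_blkOf_ne i c hz, Complex.ofReal_zero, zero_smul, zero_smul]

/-- ★ **`(Q′*Q′(U)Λ)(z) = (Q′*_□Q′_□(V)Λ)(z)` AT A SITE OF A COMMON BLOCK** whose transporters agree: same block, same kernel row, same transporters.
[cite: Balaban1985BackgroundPropagators, (3.21) p.394, (3.24)–(3.25) p.394, p.409 l.2–5, p.410 l.14–15] -/
theorem P_apply_eq_Pb_apply {z : SiteY i} {s : BlkCubeY i c} (hzs : B6Geom246MultiLevelBoxL0.blkOf (cubeFamY i c).toDomains z = s)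
    (hs : s.1 ∈ bset i.D.toDomains)
    (hagree : ∀ w, B6Geom246MultiLevelBoxL0.blkOf (cubeFamY i c).toDomains w = s → parS U (blkCornerCubeY i c s) w = parS V (blkCornerCubeY i c s) w)
    (Λ : SiteY i → 𝔸) :
    QpsY i parS U (QpY i parS U Λ) z = QpsCubeY i c parS V (QpCubeY i c parS V Λ) z := by
  have hts : (blkOf i.D.toDomains z).1 = s.1 := by
    have h := blkOf_val_eq_of_mem i c (z := z) (hzs ▸ hs : (B6Geom246MultiLevelBoxL0.blkOf (cubeFamY i c).toDomains z).1 ∈ bset i.D.toDomains)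
    rw [h, hzs]
  rw [QpsY_apply, QpsCubeY_apply, hzs, QpY_apply_eq_QpCubeY_apply i c parS U hts Λ, QpCubeY_apply_congr_cfg i c parS U V hagree Λ,
    qpT_eq_qpTc i c parS U hts z]
  show R (parS U (blkCornerCubeY i c s) z)⁻¹ _ = R (parS V (blkCornerCubeY i c s) z)⁻¹ _
  rw [hagree z hzs]

/-- ★★ **THE LEFT NEAR-AGREEMENT `M_χ·Q′*Q′(U) = M_χ·Q′*_□Q′_□(V)`** for a cut-off supported on sites of common blocks (`N`) on which the transporters of `U`, `V` agree.
[cite: Balaban1985BackgroundPropagators, (3.21) p.394, (3.24)–(3.25) p.394, Cor. 3.6 p.408 l.11–14, p.409 l.2–5, p.410 l.14–15] -/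
theorem cutMulY_P_eq_cutMulY_Pb (χ : SiteY i → ℝ) (N : Finset (BlkCubeY i c)) (hN : ∀ s ∈ N, s.1 ∈ bset i.D.toDomains)
    (hχ : ∀ z, χ z ≠ 0 → B6Geom246MultiLevelBoxL0.blkOf (cubeFamY i c).toDomains z ∈ N)
    (hagree : ∀ s ∈ N, ∀ w, B6Geom246MultiLevelBoxL0.blkOf (cubeFamY i c).toDomains w = s → parS U (blkCornerCubeY i c s) w = parS V (blkCornerCubeY i c s) w) :
    cutMulY (𝔸 := 𝔸) χ * (QpsY i parS U ∘ₗ QpY i parS U) = cutMulY (𝔸 := 𝔸) χ * (QpsCubeY i c parS V ∘ₗ QpCubeY i c parS V) := by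
  refine LinearMap.ext fun Λ => funext fun z => ?_
  rw [Module.End.mul_apply, Module.End.mul_apply, LinearMap.comp_apply, LinearMap.comp_apply, cutMulY_apply, cutMulY_apply]
  by_cases h0 : χ z = 0
  · rw [h0, Complex.ofReal_zero, zero_smul, zero_smul]
  · have hsN := hχ z h0
    rw [P_apply_eq_Pb_apply i c parS U V rfl (hN _ hsN) (hagree _ hsN) Λ]

/-- ★★ **THE RIGHT NEAR-AGREEMENT `Q′*Q′(U)·M_χ′ = Q′*_□Q′_□(V)·M_χ′`** for a cut-off supported on sites of common blocks on which the transporters agree: a row either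
meets the support (then its block is common and §1 applies) or both sides vanish (block-locality of `Q′`, `Q′_□`).
[cite: Balaban1985BackgroundPropagators, (3.21) p.394, (3.24)–(3.25) p.394, Cor. 3.6 p.408 l.11–14, p.409 l.2–5, p.410 l.14–15] -/
theorem P_mul_cutMulY_eq_Pb_mul_cutMulY (χ' : SiteY i → ℝ) (N : Finset (BlkCubeY i c)) (hN : ∀ s ∈ N, s.1 ∈ bset i.D.toDomains)
    (hχ' : ∀ z, χ' z ≠ 0 → B6Geom246MultiLevelBoxL0.blkOf (cubeFamY i c).toDomains z ∈ N)
    (hagree : ∀ s ∈ N, ∀ w, B6Geom246MultiLevelBoxL0.blkOf (cubeFamY i c).toDomains w = s → parS U (blkCornerCubeY i c s) w = parS V (blkCornerCubeY i c s) w) :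
    (QpsY i parS U ∘ₗ QpY i parS U) * cutMulY (𝔸 := 𝔸) χ' = (QpsCubeY i c parS V ∘ₗ QpCubeY i c parS V) * cutMulY (𝔸 := 𝔸) χ' := by
  refine LinearMap.ext fun Λ => funext fun z => ?_
  rw [Module.End.mul_apply, Module.End.mul_apply, LinearMap.comp_apply, LinearMap.comp_apply]
  set s₀ := B6Geom246MultiLevelBoxL0.blkOf (cubeFamY i c).toDomains z with hs₀
  by_cases hex : ∃ w, B6Geom246MultiLevelBoxL0.blkOf (cubeFamY i c).toDomains w = s₀ ∧ χ' w ≠ 0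
  · obtain ⟨w, hw, hw0⟩ := hex
    have hsN : s₀ ∈ N := hw ▸ hχ' w hw0
    exact P_apply_eq_Pb_apply i c parS U V rfl (hN _ hsN) (hagree _ hsN) _
  · -- both sides vanish: no site of the block of `z` (cube side: `s₀`; member side: the block of `z`) meets `supp χ′`
    have hex' : ∀ w, B6Geom246MultiLevelBoxL0.blkOf (cubeFamY i c).toDomains w = s₀ → χ' w = 0 := fun w hw => by
      by_contra h; exact hex ⟨w, hw, h⟩
    have hR0 : QpCubeY i c parS V (cutMulY (𝔸 := 𝔸) χ' Λ) s₀ = 0 := by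
      refine QpCubeY_apply_eq_zero_of i c parS V _ s₀ fun w hw => ?_
      rw [cutMulY_apply, hex' w hw, Complex.ofReal_zero, zero_smul]
    have hL0 : QpY i parS U (cutMulY (𝔸 := 𝔸) χ' Λ) (blkOf i.D.toDomains z) = 0 := by
      refine QpY_apply_eq_zero_of i parS U _ _ fun w hw => ?_
      rw [cutMulY_apply]
      by_cases hw0 : χ' w = 0
      · rw [hw0, Complex.ofReal_zero, zero_smul]
      · exfalso
        -- `w ∈ supp χ′` ⇒ its cube block is common ⇒ the member block of `w` (= that of `z`) is that cube block ⇒ `z`'s cube block is it too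
        have hwN := hχ' w hw0
        have hval : (blkOf i.D.toDomains w).1 = (B6Geom246MultiLevelBoxL0.blkOf (cubeFamY i c).toDomains w).1 :=
          blkOf_val_eq_of_mem i c (hN _ hwN)
        rw [hw] at hval
        have hzs : B6Geom246MultiLevelBoxL0.blkOf (cubeFamY i c).toDomains z = B6Geom246MultiLevelBoxL0.blkOf (cubeFamY i c).toDomains w :=
          (blkOf_eq_iff_of_val_eq i c hval z).1 rfl
        exact hw0 (hex' w (by rw [hs₀, hzs]))
    rw [QpsY_apply, QpsCubeY_apply, hL0, R_zero, ← hs₀, hR0, R_zero]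

/-! ### the located resolvent identity with everything but the units DISCHARGED -/

variable (Gp : SiteOpY 𝔸 i)

/-- ★★★ **THE EXACT LOCATED RESOLVENT IDENTITY, ALL STRUCTURAL HYPOTHESES DISCHARGED BUT THE UNITS**: for cut-offs `χ, χ′` supported on sites of a set `N` of common
blocks on which the averaging transporters of `U` and `V` agree, and `X(U)`, `X_□(V)` invertible,
`M_χ·(S(U) − S_□(V))·M_χ′ = M_χ·Q′*X⁻¹·(T·X_□ − X·T)·X_□⁻¹Q′_□·M_χ′`.
[cite: Balaban1985BackgroundPropagators, (3.95) p.411, p.412 l.22–36, p.415 l.29–37, (3.21) p.394, (3.25) p.394, Cor. 3.6 p.408; Balaban1983RegularityDecay, (1.11)–(1.12) (statement type; algebra ours)] -/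
theorem cut_locCDiff_cut_eq_of_window (χ χ' : SiteY i → ℝ) (N : Finset (BlkCubeY i c)) (hN : ∀ s ∈ N, s.1 ∈ bset i.D.toDomains)
    (hχ : ∀ z, χ z ≠ 0 → B6Geom246MultiLevelBoxL0.blkOf (cubeFamY i c).toDomains z ∈ N)
    (hχ' : ∀ z, χ' z ≠ 0 → B6Geom246MultiLevelBoxL0.blkOf (cubeFamY i c).toDomains z ∈ N)
    (hagree : ∀ s ∈ N, ∀ w, B6Geom246MultiLevelBoxL0.blkOf (cubeFamY i c).toDomains w = s → parS U (blkCornerCubeY i c s) w = parS V (blkCornerCubeY i c s) w)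
    (hX : IsUnit (XY i parS Gp U)) (hXc : IsUnit (XCubeY i c parS V)) :
    cutMulY (𝔸 := 𝔸) χ * ((QpsY i parS U ∘ₗ XinvY i parS Gp U ∘ₗ QpY i parS U) - (QpsCubeY i c parS V ∘ₗ XinvCubeY i c parS V ∘ₗ QpCubeY i c parS V)) *
        cutMulY (𝔸 := 𝔸) χ' =
      cutMulY (𝔸 := 𝔸) χ * (QpsY i parS U ∘ₗ XinvY i parS Gp U ∘ₗ
        ((QpY i parS U ∘ₗ QpsCubeY i c parS V) ∘ₗ XCubeY i c parS V - XY i parS Gp U ∘ₗ (QpY i parS U ∘ₗ QpsCubeY i c parS V)) ∘ₗ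
          XinvCubeY i c parS V ∘ₗ QpCubeY i c parS V) * cutMulY (𝔸 := 𝔸) χ' :=
  cut_locCDiff_cut_eq' i c parS Gp U V χ χ' hX hXc (cutMulY_P_eq_cutMulY_Pb i c parS U V χ N hN hχ hagree)
    (P_mul_cutMulY_eq_Pb_mul_cutMulY i c parS U V χ' N hN hχ' hagree)

end Window

end Literature.MathematicalPhysics.QuantumFieldTheory.Balaban1983to89.B9Eq3105FamThreeLocResolvent

end
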